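import Literature.Probability.RandomPlanarGeometry.SLEImageLocalisation
import Literature.Probability.RandomPlanarGeometry.SLEImageDriverEnvelope
import Literature.Probability.RandomPlanarGeometry.SLERestrictionBoundaryKappa
import Literature.Probability.RandomPlanarGeometry.LoewnerImageClock
import HarnessLib

/-!
# The localised image driving process of SLE_κ under a `*`-hull: pathwise properties

Sequel of `SLEImageLocalisation` ([LSW] 2003 §5; Lawler–Schramm–Werner (2001) Thm. 2.2): pathwise
facts about the continuous modification `imgDrvFnK` of the image driving function
`W̃_t = W_t + L_A − L_{B_t}`, the localising time `imgLocTimeK = Tₙ ∧ capTimeK`, the stopped process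
`imgMartK` and the bracket clock `imgClockK` (theorems only):

* `continuous_LhatFnK`, `continuous_imgDrvFnK`, `continuous_imgMartK` — continuity of paths (at
  alive times `t ↦ L_{B_t}` is continuous, `continuousWithinAt_imageDriver`; at the death time the
  taper `(n+1) R_t → 0` kills the locally bounded `L_{B_t}`, `abs_LFnK_le`);
* `abs_drvK_le_of_le_imgLocTimeK`, `imgDrvP_eq_of_le`, `imgMartK_eq_imageDriver` — up to and
  including the (positive) localising time the driver is bounded by `n + 1` and the process IS the
  image driving function `Loewner.imageDriver` of `LoewnerImageFlow`;
* `abs_imgMartK_le` — the stopped process is bounded (uniformly in `t, ω`);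
* `continuous_imgClockK`, `imgClockK_mono`, `imgClockK_sub_le`, `imgClockK_lt_of_lt`,
  `imgClockK_eq_imageClock` — the clock has continuous nondecreasing `1`-Lipschitz paths, is strictly
  increasing up to the localising time, and agrees there with the deterministic capacity clock
  `Loewner.imageClock` of `LoewnerImageClock`.

## References

* [LSW] 2003, §5. [LawlerSchrammWerner2003Restriction]
* G. F. Lawler, O. Schramm, W. Werner, Acta Math. **187** (2001), Thm. 2.2. [LawlerSchrammWerner2001]
-/

noncomputable section

open Set Filter Metric Function MeasureTheory
open _root_.Complex _root_.Topology
open Literature.Probability.Process (brownian preWienerMeasure)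
open Literature.Analysis.FunctionSpaces (timeIntegral trunc)
open scoped NNReal

namespace Literature.Probability.RandomPlanarGeometry

open Loewner PathOps

variable {κ : ℝ≥0} {A : Set ℂ} {hA : IsStarHull A} {hne : A.Nonempty} {n : ℕ}

/-! ### Continuity of paths -/

section Paths

/-- **At an alive time `t ↦ L_{B_t} 𝟙{alive}` is continuous** (the alive times form a neighbourhood,
`exists_lt_disjoint`; `L_{B_t} = W_t + L_A − W̃_t` with `W̃` continuous there,
`continuousWithinAt_imageDriver`). [cite: LawlerSchrammWerner2003Restriction, §5 (W̃ continuous)] -/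
theorem continuousAt_LFnK_of_alive (hA : IsStarHull A) (hne : A.Nonempty) {t₀ : ℝ≥0} {υ : C(ℝ≥0, ℝ)}
    (h₀ : Disjoint (closedHull (drvK κ υ) t₀) A) : ContinuousAt (fun t ↦ LFnK κ A t υ) t₀ := by
  have hW := continuous_drvK κ υ
  obtain ⟨t₁, ht₁, halive₁⟩ := exists_lt_disjoint (W := fun υ : C(ℝ≥0, ℝ) ↦ drvK κ υ) hW hA h₀
  have hnhds : Iio t₁ ∈ 𝓝 t₀ := Iio_mem_nhds ht₁
  have hsub : Iio t₁ ⊆ {v | Disjoint (closedHull (drvK κ υ) v) A} := fun v hv ↦ alive_mono (le_of_lt hv) halive₁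
  have hdrv : ContinuousAt (fun v : ℝ≥0 ↦ imageDriver (drvK κ υ) A v) t₀ :=
    (continuousWithinAt_imageDriver hW hA hne h₀).continuousAt (Filter.mem_of_superset hnhds hsub)
  have hcomb : ContinuousAt (fun v : ℝ≥0 ↦ drvK κ υ v + (starShift A).re - imageDriver (drvK κ υ) A v) t₀ :=
    (hW.continuousAt.add continuousAt_const).sub hdrv
  refine hcomb.congr ?_
  filter_upwards [hnhds] with v hv
  rw [LFnK_of_alive (hsub hv), imageDriver]; ring

/-- **`t ↦ L̂ⁿ_t(υ)` is continuous for every path.** [folklore] -/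
theorem continuous_LhatFnK (n : ℕ) (υ : C(ℝ≥0, ℝ)) : Continuous fun t ↦ LhatFnK κ hA hne n t υ := by
  have hW := continuous_drvK κ υ
  have hRc := continuous_RFnK (κ := κ) (hA := hA) (hne := hne) υ
  have htaper : Continuous fun t ↦ min 1 (((n : ℝ) + 1) * RFnK κ hA hne t υ) :=
    continuous_const.min (continuous_const.mul hRc)
  refine continuous_iff_continuousAt.2 fun t₀ ↦ ?_
  by_cases h₀ : Disjoint (closedHull (drvK κ υ) t₀) A
  · simp only [LhatFnK_def]
    exact (continuousAt_LFnK_of_alive hA hne h₀).mul htaper.continuousAt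
  · -- dead: `L̂ t₀ = 0`, `|L̂ t| ≤ K (n+1) R_t → 0`
    have hR0 : RFnK κ hA hne t₀ υ = 0 :=
      aliveFn_eq_zero_of_not_disjoint (W := fun υ : C(ℝ≥0, ℝ) ↦ drvK κ υ) hW (drvK_zero κ υ) hA (denseSeq_spec hA hne).2
        (fun k ↦ ((denseSeq_spec hA hne).1 k).2) h₀
    have hL0 : LhatFnK κ hA hne n t₀ υ = 0 := by rw [LhatFnK_def, hR0, mul_zero, min_eq_right zero_le_one, mul_zero]
    rw [ContinuousAt, hL0]
    -- a local bound of `L_{B_t}`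
    obtain ⟨R₁, hR₁⟩ := hA.isBoundedHull.isCompact.isBounded.subset_closedBall (0 : ℂ)
    set R : ℝ := max R₁ 1 with hR
    have hRpos : 0 < R := lt_max_of_lt_right one_pos
    have hAR : A ⊆ closedBall (0 : ℂ) R := hR₁.trans (closedBall_subset_closedBall (le_max_left _ _))
    obtain ⟨C, hC⟩ := isCompact_Icc.exists_bound_of_continuousOn (s := Icc (0 : ℝ≥0) (t₀ + 1)) hW.continuousOn
    set M : ℝ := max C 0 with hM
    set K : ℝ := 580 * (3 * M + 13 * Real.sqrt ((t₀ + 1 : ℝ≥0) : ℝ) + R) with hK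
    have hbound : ∀ t, t < t₀ + 1 → |LFnK κ A t υ| ≤ K := by
      intro t ht
      have hMt : ∀ s : ℝ≥0, s ≤ t → |drvK κ υ s| ≤ M := fun s hs ↦ by
        have := hC s ⟨bot_le, hs.trans ht.le⟩
        rw [Real.norm_eq_abs] at this
        exact this.trans (le_max_left _ _)
      refine (abs_LFnK_le hA hRpos hAR (le_max_right _ _) hMt).trans ?_
      have : Real.sqrt (t : ℝ) ≤ Real.sqrt ((t₀ + 1 : ℝ≥0) : ℝ) := Real.sqrt_le_sqrt (by exact_mod_cast ht.le)
      rw [hK]; nlinarith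
    have hev : ∀ᶠ t in 𝓝 t₀, ‖LhatFnK κ hA hne n t υ‖ ≤ K * (((n : ℝ) + 1) * RFnK κ hA hne t υ) := by
      filter_upwards [Iio_mem_nhds (show t₀ < t₀ + 1 from lt_add_one t₀)] with t ht
      rw [Real.norm_eq_abs]
      have hR' := RFnK_nonneg (κ := κ) (hA := hA) (hne := hne) t υ
      exact (abs_LhatFnK_le_mul n t υ).trans (mul_le_mul_of_nonneg_right (hbound t ht) (by positivity))
    have hlim : Tendsto (fun t ↦ K * (((n : ℝ) + 1) * RFnK κ hA hne t υ)) (𝓝 t₀) (𝓝 0) := by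
      have h1 : ContinuousAt (fun t ↦ K * (((n : ℝ) + 1) * RFnK κ hA hne t υ)) t₀ :=
        (continuous_const.mul (continuous_const.mul hRc)).continuousAt
      have h2 : K * (((n : ℝ) + 1) * RFnK κ hA hne t₀ υ) = 0 := by rw [hR0]; ring
      rw [ContinuousAt, h2] at h1
      exact h1
    exact squeeze_zero_norm' hev hlim

/-- **`t ↦ imgDrvFnK n t υ` is continuous for every path.** [folklore] -/
theorem continuous_imgDrvFnK (n : ℕ) (υ : C(ℝ≥0, ℝ)) : Continuous fun t ↦ imgDrvFnK κ hA hne n t υ := by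
  simp only [imgDrvFnK_def]
  exact ((continuous_drvK κ υ).add continuous_const).sub (continuous_LhatFnK n υ)

/-- The paths of `imgDrvP` are continuous. [folklore] -/
theorem continuous_imgDrvP (n : ℕ) (ω : ℝ≥0 → ℝ) : Continuous fun t ↦ imgDrvP κ hA hne n t ω :=
  continuous_imgDrvFnK n _

/-- **The paths of the stopped process `Mⁿ` are continuous.** [folklore] -/
theorem continuous_imgMartK (n : ℕ) (ω : ℝ≥0 → ℝ) : Continuous fun t ↦ imgMartK κ hA hne n t ω :=
  Literature.Analysis.FunctionSpaces.continuous_stoppedProcess_apply (X := imgDrvP κ hA hne n) (continuous_imgDrvP n ω) _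

end Paths

/-! ### The process up to the localising time -/

section Control

/-- Before the cap time the driver is bounded: `|W_t| < n + 1`. [folklore] -/
theorem abs_drvK_lt_of_lt_capTimeK {t : ℝ≥0} {ω : ℝ≥0 → ℝ} (ht : (t : WithTop ℝ≥0) < capTimeK κ n ω) :
    |drvK κ (brownianCPath ω) t| < (n : ℝ) + 1 :=
  not_le.1 (Process.notMem_of_coe_lt_hittingAfter_zero ht)

/-- **Up to and including the localising time the driver is bounded by `n + 1`** (strictly before
the cap time; at the cap time by continuity from the left). [folklore] -/
theorem abs_drvK_le_of_le_imgLocTimeK {s : ℝ≥0} {ω : ℝ≥0 → ℝ} (hs : (s : WithTop ℝ≥0) ≤ imgLocTimeK κ hA hne n ω) :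
    |drvK κ (brownianCPath ω) s| ≤ (n : ℝ) + 1 := by
  have hsc : (s : WithTop ℝ≥0) ≤ capTimeK κ n ω := hs.trans (imgLocTimeK_le_capTimeK n ω)
  rcases hsc.lt_or_eq with hlt | heq
  · exact (abs_drvK_lt_of_lt_capTimeK hlt).le
  · rcases eq_or_ne s 0 with rfl | hs0
    · rw [drvK_zero, abs_zero]; positivity
    · have hs0' : 0 < s := pos_iff_ne_zero.2 hs0
      haveI : (𝓝[<] s).NeBot := nhdsLT_neBot_of_exists_lt ⟨0, hs0'⟩
      have hev : ∀ᶠ r in 𝓝[<] s, |drvK κ (brownianCPath ω) r| ≤ (n : ℝ) + 1 := by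
        filter_upwards [self_mem_nhdsWithin] with r hr
        have hr' : (r : WithTop ℝ≥0) < capTimeK κ n ω := by rw [← heq]; exact_mod_cast hr
        exact (abs_drvK_lt_of_lt_capTimeK hr').le
      have hc : Continuous fun r ↦ |drvK κ (brownianCPath ω) r| := (continuous_drvK κ _).abs
      exact le_of_tendsto (hc.continuousAt.tendsto.mono_left nhdsWithin_le_nhds) hev

/-- **Up to and including the (positive) localising time, `imgDrvP` is the image driving function**:
`imgDrvP n t ω = imageDrvFnK κ A t (β ω) + L_A = Loewner.imageDriver W A t` (`W = drvK κ (β ω)`), and the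
path is alive at `t`. [cite: LawlerSchrammWerner2003Restriction, §5 (W̃_t = h_t(W_t))] -/
theorem imgDrvP_eq_of_le {t : ℝ≥0} {ω : ℝ≥0 → ℝ} (ht : (t : WithTop ℝ≥0) ≤ imgLocTimeK κ hA hne n ω)
    (h0 : (0 : WithTop ℝ≥0) < imgLocTimeK κ hA hne n ω) :
    Disjoint (closedHull (drvK κ (brownianCPath ω)) t) A ∧
      imgDrvP κ hA hne n t ω = imageDrvFnK κ A t (brownianCPath ω) + (starShift A).re ∧
      imgDrvP κ hA hne n t ω = imageDriver (drvK κ (brownianCPath ω)) A t := by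
  have hT0 : (0 : WithTop ℝ≥0) < locTimeK κ hA hne n ω := h0.trans_le (imgLocTimeK_le_locTimeK n ω)
  have htT : (t : WithTop ℝ≥0) ≤ locTimeK κ hA hne n ω := ht.trans (imgLocTimeK_le_locTimeK n ω)
  obtain ⟨halive, hR, -, -, -⟩ := controlled_of_le_locTimeK htT hT0
  obtain ⟨-, hR0, -, -, -⟩ := controlled_of_le_locTimeK (t := 0) (by exact_mod_cast bot_le) hT0
  have hLt : LhatFnK κ hA hne n t (brownianCPath ω) = LFnK κ A t (brownianCPath ω) := LhatFnK_eq_of_le hR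
  have hL0 : LhatFnK κ hA hne n 0 (brownianCPath ω) = (starShift A).re := by rw [LhatFnK_eq_of_le hR0, LFnK_zero hA]
  have h1 : imgDrvP κ hA hne n t ω = imageDrvFnK κ A t (brownianCPath ω) + (starShift A).re := by
    rw [imgDrvP_def, imgDrvFnK_def, hLt, hL0, imageDrvFnK]; ring
  refine ⟨halive, h1, ?_⟩
  rw [h1, imageDrvFnK_of_alive halive, imageDriver]; ring

/-- Up to the localising time the stopped process is the unstopped one. [folklore] -/
theorem imgMartK_eq_of_le {t : ℝ≥0} {ω : ℝ≥0 → ℝ} (ht : (t : WithTop ℝ≥0) ≤ imgLocTimeK κ hA hne n ω) :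
    imgMartK κ hA hne n t ω = imgDrvP κ hA hne n t ω := by
  rw [imgMartK_apply, min_eq_left ht]; rfl

/-- From the localising time on the stopped process is frozen. [folklore] -/
theorem imgMartK_eq_of_ge {t : ℝ≥0} {ω : ℝ≥0 → ℝ} {T : ℝ≥0} (hT : imgLocTimeK κ hA hne n ω = T) (ht : T ≤ t) :
    imgMartK κ hA hne n t ω = imgDrvP κ hA hne n T ω := by
  rw [imgMartK_apply, hT, min_eq_right (by exact_mod_cast ht)]; rfl

/-- **Up to and including the (positive) localising time, `Mⁿ_t = W̃_t = Loewner.imageDriver W A t`.**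
[cite: LawlerSchrammWerner2003Restriction, §5 (W̃_t = h_t(W_t))] -/
theorem imgMartK_eq_imageDriver {t : ℝ≥0} {ω : ℝ≥0 → ℝ} (ht : (t : WithTop ℝ≥0) ≤ imgLocTimeK κ hA hne n ω)
    (h0 : (0 : WithTop ℝ≥0) < imgLocTimeK κ hA hne n ω) :
    imgMartK κ hA hne n t ω = imageDriver (drvK κ (brownianCPath ω)) A t := by
  rw [imgMartK_eq_of_le ht]; exact (imgDrvP_eq_of_le ht h0).2.2

/-- **The bound of `imgDrvP` up to the (positive) localising time**:
`|imgDrvP n t ω| ≤ (n+1) + 1160 (3(n+1) + 13√(n+1) + R)` for `A ⊆ B̄(0, R)`. [folklore] -/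
theorem abs_imgDrvP_le_of_le {R : ℝ} (hR0 : 0 < R) (hAR : A ⊆ closedBall (0 : ℂ) R) {t : ℝ≥0} {ω : ℝ≥0 → ℝ}
    (ht : (t : WithTop ℝ≥0) ≤ imgLocTimeK κ hA hne n ω) :
    |imgDrvP κ hA hne n t ω| ≤ ((n : ℝ) + 1) + 1160 * (3 * ((n : ℝ) + 1) + 13 * Real.sqrt ((n : ℝ) + 1) + R) := by
  have hM : ∀ s : ℝ≥0, s ≤ t → |drvK κ (brownianCPath ω) s| ≤ (n : ℝ) + 1 := fun s hs ↦
    abs_drvK_le_of_le_imgLocTimeK ((WithTop.coe_le_coe.2 hs).trans ht)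
  have hM0 : ∀ s : ℝ≥0, s ≤ 0 → |drvK κ (brownianCPath ω) s| ≤ (n : ℝ) + 1 := fun s hs ↦
    hM s (hs.trans bot_le)
  have hn : (0 : ℝ) ≤ (n : ℝ) + 1 := by positivity
  have htn : (t : ℝ) ≤ (n : ℝ) + 1 := by
    have := ht.trans (imgLocTimeK_le n ω)
    exact_mod_cast (WithTop.coe_le_coe.1 this)
  have hsq : Real.sqrt (t : ℝ) ≤ Real.sqrt ((n : ℝ) + 1) := Real.sqrt_le_sqrt htn
  have hsq0 : Real.sqrt ((0 : ℝ≥0) : ℝ) ≤ Real.sqrt ((n : ℝ) + 1) := Real.sqrt_le_sqrt (by push_cast; positivity)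
  have e1 := (abs_LhatFnK_le (κ := κ) (hA := hA) (hne := hne) n t (brownianCPath ω)).trans (abs_LFnK_le hA hR0 hAR hn hM)
  have e0 := (abs_LhatFnK_le (κ := κ) (hA := hA) (hne := hne) n 0 (brownianCPath ω)).trans (abs_LFnK_le hA hR0 hAR hn hM0)
  have eW := hM t le_rfl
  rw [imgDrvP_def, imgDrvFnK_def]
  calc _ ≤ |drvK κ (brownianCPath ω) t + LhatFnK κ hA hne n 0 (brownianCPath ω)| + |LhatFnK κ hA hne n t (brownianCPath ω)| :=
        abs_sub _ _
    _ ≤ |drvK κ (brownianCPath ω) t| + |LhatFnK κ hA hne n 0 (brownianCPath ω)| + |LhatFnK κ hA hne n t (brownianCPath ω)| := by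
        gcongr; exact abs_add_le _ _
    _ ≤ ((n : ℝ) + 1) + 580 * (3 * ((n : ℝ) + 1) + 13 * Real.sqrt ((0 : ℝ≥0) : ℝ) + R) +
          580 * (3 * ((n : ℝ) + 1) + 13 * Real.sqrt (t : ℝ) + R) := by gcongr
    _ ≤ _ := by nlinarith [hsq, hsq0, Real.sqrt_nonneg ((n : ℝ) + 1)]

/-- **`Mⁿ` is bounded**: `|imgMartK n t ω| ≤ (n+1) + 1160 (3(n+1) + 13√(n+1) + R)` for all `t, ω`
(`A ⊆ B̄(0, R)`). [folklore] -/
theorem abs_imgMartK_le {R : ℝ} (hR0 : 0 < R) (hAR : A ⊆ closedBall (0 : ℂ) R) (t : ℝ≥0) (ω : ℝ≥0 → ℝ) :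
    |imgMartK κ hA hne n t ω| ≤ ((n : ℝ) + 1) + 1160 * (3 * ((n : ℝ) + 1) + 13 * Real.sqrt ((n : ℝ) + 1) + R) := by
  rw [imgMartK_apply]
  exact abs_imgDrvP_le_of_le hR0 hAR (Literature.Analysis.FunctionSpaces.coe_untopA_min_le t _)

/-- `Mⁿ` is bounded by some constant, uniformly in `t, ω`. [folklore] -/
theorem exists_forall_abs_imgMartK_le (hA : IsStarHull A) (hne : A.Nonempty) (n : ℕ) :
    ∃ N : ℝ, 0 ≤ N ∧ ∀ t ω, |imgMartK κ hA hne n t ω| ≤ N := by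
  obtain ⟨R₁, hR₁⟩ := hA.isBoundedHull.isCompact.isBounded.subset_closedBall (0 : ℂ)
  set R : ℝ := max R₁ 1 with hR
  have hR0 : 0 < R := lt_max_of_lt_right one_pos
  have hAR : A ⊆ closedBall (0 : ℂ) R := hR₁.trans (closedBall_subset_closedBall (le_max_left _ _))
  exact ⟨_, by positivity, abs_imgMartK_le hR0 hAR⟩

end Control

/-! ### The bracket clock, pathwise -/

section Clock

/-- The truncated rate, read in real time, is measurable for every path (continuous rate times the
indicator of the time set `{s | s.toNNReal ≤ T}`). [folklore] -/
theorem measurable_trunc_imgRateK (n : ℕ) (ω : ℝ≥0 → ℝ) :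
    Measurable fun s : ℝ ↦ trunc (imgLocTimeK κ hA hne n) (imgRateK κ hA hne n) s.toNNReal ω := by
  obtain ⟨T, hT⟩ := WithTop.ne_top_iff_exists.1 (imgLocTimeK_ne_top (κ := κ) (hA := hA) (hne := hne) n ω)
  have hrate : Continuous fun s : ℝ ↦ imgRateK κ hA hne n s.toNNReal ω := by
    simp only [imgRateK_def]
    exact ((continuous_RpK_DhatpK (κ := κ) (hA := hA) (hne := hne) (n + 1) ω).2.comp continuous_real_toNNReal).pow 2
  have heq : (fun s : ℝ ↦ trunc (imgLocTimeK κ hA hne n) (imgRateK κ hA hne n) s.toNNReal ω) =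
      (Iic (T : ℝ)).indicator fun s : ℝ ↦ imgRateK κ hA hne n s.toNNReal ω := by
    funext s
    rw [Literature.Analysis.FunctionSpaces.trunc_apply, Set.indicator_apply]
    have hiff : ((s.toNNReal : WithTop ℝ≥0) ≤ imgLocTimeK κ hA hne n ω) ↔ s ∈ Iic (T : ℝ) := by
      rw [← hT, WithTop.coe_le_coe, mem_Iic, Real.toNNReal_le_iff_le_coe]
    by_cases h : s ∈ Iic (T : ℝ)
    · rw [if_pos (hiff.2 h), if_pos h]
    · rw [if_neg (fun h' ↦ h (hiff.1 h')), if_neg h]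
  rw [heq]
  exact hrate.measurable.indicator measurableSet_Iic

/-- `0 ≤ truncated rate ≤ 1`. [folklore] -/
theorem trunc_imgRateK_mem_Icc (n : ℕ) (s : ℝ≥0) (ω : ℝ≥0 → ℝ) :
    trunc (imgLocTimeK κ hA hne n) (imgRateK κ hA hne n) s ω ∈ Icc (0 : ℝ) 1 := by
  rw [Literature.Analysis.FunctionSpaces.trunc_apply]
  split_ifs
  · exact imgRateK_mem_Icc n s ω
  · exact ⟨le_rfl, zero_le_one⟩

/-- The truncated rate is integrable on bounded time intervals. [folklore] -/
theorem intervalIntegrable_trunc_imgRateK (n : ℕ) (ω : ℝ≥0 → ℝ) (a b : ℝ) :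
    IntervalIntegrable (fun s : ℝ ↦ trunc (imgLocTimeK κ hA hne n) (imgRateK κ hA hne n) s.toNNReal ω) volume a b := by
  refine (Measure.integrableOn_of_bounded (M := 1) (s := uIcc a b) (by rw [uIcc]; exact measure_Icc_lt_top.ne)
    (measurable_trunc_imgRateK n ω).aestronglyMeasurable ?_).intervalIntegrable
  filter_upwards with s
  obtain ⟨h0, h1⟩ := trunc_imgRateK_mem_Icc (κ := κ) (hA := hA) (hne := hne) n s.toNNReal ω
  rw [Real.norm_eq_abs, abs_of_nonneg h0]; exact h1

/-- The truncated rate is integrable on `[0, t]`. [folklore] -/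
theorem integrableOn_trunc_imgRateK (n : ℕ) (ω : ℝ≥0 → ℝ) (t : ℝ≥0) :
    IntegrableOn (fun s : ℝ ↦ trunc (imgLocTimeK κ hA hne n) (imgRateK κ hA hne n) s.toNNReal ω) (Icc 0 t) := by
  refine Measure.integrableOn_of_bounded (M := 1) measure_Icc_lt_top.ne (measurable_trunc_imgRateK n ω).aestronglyMeasurable ?_
  filter_upwards with s
  obtain ⟨h0, h1⟩ := trunc_imgRateK_mem_Icc (κ := κ) (hA := hA) (hne := hne) n s.toNNReal ω
  rw [Real.norm_eq_abs, abs_of_nonneg h0]; exact h1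

/-- **The clock has continuous paths.** [folklore] -/
theorem continuous_imgClockK (n : ℕ) (ω : ℝ≥0 → ℝ) : Continuous fun t ↦ imgClockK κ hA hne n t ω :=
  Literature.Analysis.FunctionSpaces.continuous_timeIntegral fun t ↦ integrableOn_trunc_imgRateK n ω t

/-- **Increments of the clock**: `imgClockK t − imgClockK s = ∫ₛᵗ truncated rate ∈ [0, t − s]` for `s ≤ t`.
[folklore] -/
theorem imgClockK_sub_mem {s t : ℝ≥0} (hst : s ≤ t) (ω : ℝ≥0 → ℝ) :
    imgClockK κ hA hne n t ω - imgClockK κ hA hne n s ω =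
        ∫ r in (s : ℝ)..t, trunc (imgLocTimeK κ hA hne n) (imgRateK κ hA hne n) r.toNNReal ω ∧
      imgClockK κ hA hne n t ω - imgClockK κ hA hne n s ω ∈ Icc (0 : ℝ) ((t : ℝ) - s) := by
  have hint := intervalIntegrable_trunc_imgRateK (κ := κ) (hA := hA) (hne := hne) n ω
  have hsub : imgClockK κ hA hne n t ω - imgClockK κ hA hne n s ω =
      ∫ r in (s : ℝ)..t, trunc (imgLocTimeK κ hA hne n) (imgRateK κ hA hne n) r.toNNReal ω := by
    rw [imgClockK_def, imgClockK_def, ← intervalIntegral.integral_add_adjacent_intervals (hint 0 s) (hint s t)]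
    ring
  refine ⟨hsub, ?_⟩
  rw [hsub]
  have hst' : (s : ℝ) ≤ t := by exact_mod_cast hst
  constructor
  · exact intervalIntegral.integral_nonneg hst' fun r _ ↦ (trunc_imgRateK_mem_Icc n _ ω).1
  · have := intervalIntegral.integral_mono_on hst' (hint s t) intervalIntegrable_const
      (fun r _ ↦ (trunc_imgRateK_mem_Icc (κ := κ) (hA := hA) (hne := hne) n r.toNNReal ω).2)
    rwa [intervalIntegral.integral_const, smul_eq_mul, mul_one] at this

/-- The clock is nonnegative. [folklore] -/
theorem imgClockK_nonneg (n : ℕ) (t : ℝ≥0) (ω : ℝ≥0 → ℝ) : 0 ≤ imgClockK κ hA hne n t ω := by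
  have := (imgClockK_sub_mem (κ := κ) (hA := hA) (hne := hne) (n := n) (show (0 : ℝ≥0) ≤ t from bot_le) ω).2.1
  rwa [imgClockK_zero, sub_zero] at this

/-- **The clock is nondecreasing.** [folklore] -/
theorem imgClockK_mono (n : ℕ) (ω : ℝ≥0 → ℝ) : Monotone fun t ↦ imgClockK κ hA hne n t ω := fun _ _ hst ↦
  sub_nonneg.1 (imgClockK_sub_mem hst ω).2.1

/-- **The clock is `1`-Lipschitz**: `imgClockK t − imgClockK s ≤ t − s` for `s ≤ t`. [folklore] -/
theorem imgClockK_sub_le {s t : ℝ≥0} (hst : s ≤ t) (ω : ℝ≥0 → ℝ) :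
    imgClockK κ hA hne n t ω - imgClockK κ hA hne n s ω ≤ (t : ℝ) - s :=
  (imgClockK_sub_mem hst ω).2.2

/-- The clock at time `t` is at most `t`. [folklore] -/
theorem imgClockK_le (n : ℕ) (t : ℝ≥0) (ω : ℝ≥0 → ℝ) : imgClockK κ hA hne n t ω ≤ t := by
  have := imgClockK_sub_le (κ := κ) (hA := hA) (hne := hne) (n := n) (show (0 : ℝ≥0) ≤ t from bot_le) ω
  rwa [imgClockK_zero, sub_zero, NNReal.coe_zero, sub_zero] at this

/-- **Up to and including the (positive) localising time the rate is `Φ'_{B_s}(0)² ≥ cₙ²`.** [folklore] -/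
theorem trunc_imgRateK_eq_of_le {s : ℝ≥0} {ω : ℝ≥0 → ℝ} (hs : (s : WithTop ℝ≥0) ≤ imgLocTimeK κ hA hne n ω)
    (h0 : (0 : WithTop ℝ≥0) < imgLocTimeK κ hA hne n ω) :
    trunc (imgLocTimeK κ hA hne n) (imgRateK κ hA hne n) s ω = starDeriv (slidHull (drvK κ (brownianCPath ω)) A s) ^ 2 ∧
      locLevel n ^ 2 ≤ trunc (imgLocTimeK κ hA hne n) (imgRateK κ hA hne n) s ω := by
  have hT0 : (0 : WithTop ℝ≥0) < locTimeK κ hA hne n ω := h0.trans_le (imgLocTimeK_le_locTimeK n ω)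
  obtain ⟨-, -, hDeq, hd, -⟩ := controlled_of_le_locTimeK (hs.trans (imgLocTimeK_le_locTimeK n ω)) hT0
  have h1 : trunc (imgLocTimeK κ hA hne n) (imgRateK κ hA hne n) s ω = starDeriv (slidHull (drvK κ (brownianCPath ω)) A s) ^ 2 := by
    rw [Literature.Analysis.FunctionSpaces.trunc_of_le hs, imgRateK_def, hDeq]
  refine ⟨h1, ?_⟩
  rw [h1]
  exact pow_le_pow_left₀ (locLevel_pos_le n).1.le hd 2

/-- **The clock is strictly increasing up to the localising time.** [folklore] -/
theorem imgClockK_lt_of_lt {s t : ℝ≥0} {ω : ℝ≥0 → ℝ} (hst : s < t) (ht : (t : WithTop ℝ≥0) ≤ imgLocTimeK κ hA hne n ω) :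
    imgClockK κ hA hne n s ω < imgClockK κ hA hne n t ω := by
  have h0 : (0 : WithTop ℝ≥0) < imgLocTimeK κ hA hne n ω :=
    lt_of_lt_of_le (by exact_mod_cast (lt_of_le_of_lt bot_le hst)) ht
  obtain ⟨hsub, -⟩ := imgClockK_sub_mem (κ := κ) (hA := hA) (hne := hne) (n := n) hst.le ω
  have hst' : (s : ℝ) < t := by exact_mod_cast hst
  have hc := (locLevel_pos_le n).1
  have hlow : locLevel n ^ 2 * ((t : ℝ) - s) ≤ imgClockK κ hA hne n t ω - imgClockK κ hA hne n s ω := by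
    rw [hsub]
    have hmono := intervalIntegral.integral_mono_on (f := fun _ : ℝ ↦ locLevel n ^ 2) hst'.le intervalIntegrable_const
      (intervalIntegrable_trunc_imgRateK (κ := κ) (hA := hA) (hne := hne) n ω s t) (fun r hr ↦ ?_)
    · rwa [intervalIntegral.integral_const, smul_eq_mul, mul_comm] at hmono
    · have hr' : r.toNNReal ≤ t := by
        rw [← NNReal.coe_le_coe, Real.coe_toNNReal r ((NNReal.coe_nonneg s).trans hr.1)]; exact hr.2
      exact (trunc_imgRateK_eq_of_le ((WithTop.coe_le_coe.2 hr').trans ht) h0).2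
  have : 0 < locLevel n ^ 2 * ((t : ℝ) - s) := mul_pos (pow_pos hc 2) (by linarith)
  linarith

/-- **Strict monotonicity on `[0, T]`** in the form consumed by the time change. [folklore] -/
theorem strictMonoOn_imgClockK {ω : ℝ≥0 → ℝ} {T : ℝ≥0} (hT : (T : WithTop ℝ≥0) ≤ imgLocTimeK κ hA hne n ω) :
    StrictMonoOn (fun t ↦ imgClockK κ hA hne n t ω) (Icc 0 T) := fun _ _ _ ht hst ↦
  imgClockK_lt_of_lt hst ((WithTop.coe_le_coe.2 ht.2).trans hT)

/-- **Up to and including the (positive) localising time the clock is the deterministic capacity clock**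
`Loewner.imageClock W A t = ∫₀ᵗ Φ'_{B_r}(0)² dr` of `LoewnerImageClock`. [cite: LawlerSchrammWerner2003Restriction, §5 (5.1)] -/
theorem imgClockK_eq_imageClock {t : ℝ≥0} {ω : ℝ≥0 → ℝ} (ht : (t : WithTop ℝ≥0) ≤ imgLocTimeK κ hA hne n ω)
    (h0 : (0 : WithTop ℝ≥0) < imgLocTimeK κ hA hne n ω) :
    imgClockK κ hA hne n t ω = imageClock (drvK κ (brownianCPath ω)) A t := by
  rw [imgClockK_def, imageClock]
  refine intervalIntegral.integral_congr fun r hr ↦ ?_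
  rw [uIcc_of_le t.coe_nonneg] at hr
  have hr' : r.toNNReal ≤ t := by
    rw [← NNReal.coe_le_coe, Real.coe_toNNReal r hr.1]; exact hr.2
  rw [(trunc_imgRateK_eq_of_le ((WithTop.coe_le_coe.2 hr').trans ht) h0).1, imageClockRate]

end Clock

end Literature.Probability.RandomPlanarGeometry

end
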